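import Summits.CriticalPhenomena.SAWScalingLimit.Theorems.SAWTotalPositivityBoundaryHarnackGadget
import Summits.CriticalPhenomena.SAWScalingLimit.Theses.SAWTotalPositivity
import Mathlib.Analysis.SpecificLimits.Basic

/-!
# The corridor gadget for `BoundaryHarnack`: the two planar domains and the two weight bounds

Route `SAWTotalPositivity`, item stmt-CriticalPhenomena-7120 (`BoundaryHarnack`), converse /
hardness direction, part 2. With the notched half-box `Λ_N = ([-N,N] × [0,N]) \ {(0,1)}`,
`b' = (-1,0)`, `b = (0,0)`, `c = (1,0)`, `g_R = (-N,0)`, the corridor `t = (-1,-1) → … → g_R`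
(`m = 2M + N` steps) and the gadget `V = Λ_N ∪ corridor` (file `…Gadget`), realised as the bounded
simply connected planar domains `gadgetDomain N M = Ω_V`, `halfBoxDomain N = Ω_Λ` with
`(Ω_V)_1 = ℤ²[V]`, `(Ω_Λ)_1 = ℤ²[Λ_N]` (file `…Realisation`), we prove

* `weight_tb_ge`  : `x_c · Z_Λ(b', b) ≤ Z_V(t, b)` (prefix the edge `t b'`; injective);
* `weight_tb'_le` : `Z_V(t, b') ≤ x_c + x_c^m · Z_Λ(g_R, b')` (a SAW `t → b'` is the edge `t b'`,
  or its second vertex is `cor 1` and it is forced through the whole private corridor to `g_R`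
  (`getVert_eq_of_forced`), after which it is a SAW of `Λ_N`; `ω ↦ ω.drop m` is injective).

The assembly (`BoundaryHarnack` hypotheses at the gadget, limit `M → ∞`) is in `…Converse`.
Everything proved. [folklore]
-/

noncomputable section

namespace Summit.CriticalPhenomena.SAWScalingLimit.Theorems.BoundaryHarnack.Negative

open Literature.Probability.LatticeModels Literature.Probability.RandomPlanarGeometry
open Literature.Probability.RandomPlanarGeometry.SAW Set Relation Filter Topology
open Summit.CriticalPhenomena.SAWScalingLimit.Theorems.BoundaryHarnack.Realisation
open Summit.CriticalPhenomena.SAWScalingLimit.Theorems.CriticalBubbleBound.Negative (weight_univ)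
open Summit.CriticalPhenomena.SAWScalingLimit.Theses.SAWTotalPositivity (BoundaryHarnack)
open scoped ENNReal

variable {N M : ℕ}

/-! ### The two planar domains -/

/-- The bounding box of the gadget is nonempty. [folklore] -/
theorem hab_V : ∀ i, (![-(N : ℤ) - 1, -(M : ℤ)] : Site 2) i ≤ (![(N : ℤ), N] : Site 2) i :=
  Fin.forall_fin_two.2 ⟨by simp only [Matrix.cons_val_zero]; omega,
    by simp only [Matrix.cons_val_one, Matrix.cons_val_zero]; omega⟩

/-- The bounding box of the half-box is nonempty. [folklore] -/
theorem hab_Λ : ∀ i, (![-(N : ℤ), 0] : Site 2) i ≤ (![(N : ℤ), N] : Site 2) i :=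
  Fin.forall_fin_two.2 ⟨by simp only [Matrix.cons_val_zero]; omega,
    by simp only [Matrix.cons_val_one, Matrix.cons_val_zero]; omega⟩

/-- **The domain graph of `Ω_V` is `ℤ²` induced on the gadget.** [folklore] -/
theorem adjV (hN : 2 ≤ N) (hM : 2 ≤ M) {x y : Site 2} :
    (discreteDomainGraph (gadgetDomain N M) 1).Adj x y ↔
      (zdGraph 2).Adj x y ∧ x ∈ gadget N M ∧ y ∈ gadget N M :=
  adj_realise_iff (gadget_subset_boxSites hM) (gadget_connected hN hM)

/-- **The domain graph of `Ω_Λ` is `ℤ²` induced on the notched half-box.** [folklore] -/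
theorem adjΛ (hN : 2 ≤ N) {x y : Site 2} :
    (discreteDomainGraph (halfBoxDomain N) 1).Adj x y ↔
      (zdGraph 2).Adj x y ∧ x ∈ halfBox N ∧ y ∈ halfBox N :=
  adj_realise_iff halfBox_subset_boxSites (halfBox_connected hN)

/-- The discrete domain of `Ω_V` is the gadget. [folklore] -/
theorem meshDomain_V (hN : 2 ≤ N) (hM : 2 ≤ M) : meshDomain (gadgetDomain N M) 1 = gadget N M :=
  meshDomain_realise (gadget_subset_boxSites hM) (gadget_connected hN hM)

/-- The discrete domain of `Ω_Λ` is the notched half-box. [folklore] -/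
theorem meshDomain_Λ (hN : 2 ≤ N) : meshDomain (halfBoxDomain N) 1 = halfBox N :=
  meshDomain_realise halfBox_subset_boxSites (halfBox_connected hN)

/-- `ℤ²[Λ_N] ≤ ℤ²[V]`. [folklore] -/
theorem GΛ_le_GV (hN : 2 ≤ N) (hM : 2 ≤ M) :
    discreteDomainGraph (halfBoxDomain N) 1 ≤ discreteDomainGraph (gadgetDomain N M) 1 := by
  intro x y h
  rw [adjΛ hN] at h
  exact (adjV hN hM).2 ⟨h.1, Or.inl h.2.1, Or.inl h.2.2⟩

/-- Vertices of a SAW of `Ω_Λ` from a site of `Λ_N` lie in `Λ_N`. [folklore] -/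
theorem support_subset_halfBox (hN : 2 ≤ N) {u v : Site 2} (hu : u ∈ halfBox N)
    (p : (discreteDomainGraph (halfBoxDomain N) 1).Walk u v) : ∀ w ∈ p.support, w ∈ halfBox N := by
  have := support_subset_meshDomain p (by rw [meshDomain_Λ hN]; exact hu)
  rwa [meshDomain_Λ hN] at this

/-- Vertices of a SAW of `Ω_V` from a site of `V` lie in `V`. [folklore] -/
theorem support_subset_gadget (hN : 2 ≤ N) (hM : 2 ≤ M) {u v : Site 2} (hu : u ∈ gadget N M)
    (p : (discreteDomainGraph (gadgetDomain N M) 1).Walk u v) : ∀ w ∈ p.support, w ∈ gadget N M := by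
  have := support_subset_meshDomain p (by rw [meshDomain_V hN hM]; exact hu)
  rwa [meshDomain_V hN hM] at this

/-- The edge `t b'` of `ℤ²[V]`. [folklore] -/
theorem adj_t_b' (hN : 2 ≤ N) (hM : 2 ≤ M) :
    (discreteDomainGraph (gadgetDomain N M) 1).Adj ![-1, -1] ![-1, 0] :=
  (adjV hN hM).2 ⟨by decide, Or.inr (t_mem_corSet hM), Or.inl (b'_mem_halfBox hN)⟩

/-- The edge `b' b` of `ℤ²[V]`. [folklore] -/
theorem adj_b'_b (hN : 2 ≤ N) (hM : 2 ≤ M) :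
    (discreteDomainGraph (gadgetDomain N M) 1).Adj ![-1, 0] ![0, 0] :=
  (adjV hN hM).2 ⟨by decide, Or.inl (b'_mem_halfBox hN), Or.inl b_mem_halfBox⟩

/-- The edge `b c` of `ℤ²[V]`. [folklore] -/
theorem adj_b_c (hN : 2 ≤ N) (hM : 2 ≤ M) :
    (discreteDomainGraph (gadgetDomain N M) 1).Adj ![0, 0] ![1, 0] :=
  (adjV hN hM).2 ⟨by decide, Or.inl b_mem_halfBox, Or.inl (c_mem_halfBox hN)⟩

/-! ### `x_c · Z_Λ(b', b) ≤ Z_V(t, b)` -/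

/-- **Lower bound**: prefixing the edge `t b'` embeds the SAWs `b' → b` of `Λ_N` into the SAWs
`t → b` of `V`, so `x_c · Z_Λ(b',b) ≤ Z_V(t,b)`. [folklore] -/
theorem weight_tb_ge (hN : 2 ≤ N) (hM : 2 ≤ M) :
    ENNReal.ofReal criticalFugacity * SAW.weight (halfBoxDomain N) 1 ![-1, 0] ![0, 0] univ ≤
      SAW.weight (gadgetDomain N M) 1 ![-1, -1] ![0, 0] univ := by
  rw [weight_univ, weight_univ, ← ENNReal.tsum_mul_left]
  set Φ : DomainSAW (halfBoxDomain N) 1 ![-1, 0] ![0, 0] → DomainSAW (gadgetDomain N M) 1 ![-1, -1] ![0, 0] :=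
    fun β => ⟨SimpleGraph.Walk.cons (adj_t_b' hN hM) (β.walk.mapLe (GΛ_le_GV hN hM)),
      (SimpleGraph.Walk.cons_isPath_iff _ _).2 ⟨β.isPath.mapLe _, by
        rw [SimpleGraph.Walk.support_mapLe_eq_support]
        intro ht
        have := support_subset_halfBox hN (b'_mem_halfBox hN) β.walk _ ht
        rw [mem_halfBox_iff] at this
        simp at this⟩⟩ with hΦ
  have hinj : Function.Injective Φ := by
    rintro ⟨p, hp⟩ ⟨q, hq⟩ h
    have h1 := congrArg (fun γ : DomainSAW (gadgetDomain N M) 1 ![-1, -1] ![0, 0] => γ.walk.support) h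
    simp only [hΦ, SimpleGraph.Walk.support_cons, SimpleGraph.Walk.support_mapLe_eq_support,
      List.cons.injEq, true_and] at h1
    have := SimpleGraph.Walk.ext_support h1
    subst this; rfl
  have hlen : ∀ β, (Φ β).length = β.length + 1 := by
    intro β
    have h1 : (Φ β).walk.support = ![-1, -1] :: β.walk.support := by
      simp only [hΦ, SimpleGraph.Walk.support_cons, SimpleGraph.Walk.support_mapLe_eq_support]
    have h2 := (Φ β).walk.length_support
    have h3 := β.walk.length_support
    rw [h1, List.length_cons] at h2
    unfold DomainSAW.length
    omega
  calc ∑' β : DomainSAW (halfBoxDomain N) 1 ![-1, 0] ![0, 0],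
        ENNReal.ofReal criticalFugacity * ENNReal.ofReal (criticalFugacity ^ β.length)
      = ∑' β : DomainSAW (halfBoxDomain N) 1 ![-1, 0] ![0, 0],
          (fun γ : DomainSAW (gadgetDomain N M) 1 ![-1, -1] ![0, 0] =>
            ENNReal.ofReal (criticalFugacity ^ γ.length)) (Φ β) := by
        congr 1; funext β
        simp only [hlen β, pow_succ, mul_comm (criticalFugacity ^ β.length)]
        rw [ENNReal.ofReal_mul criticalFugacity_pos_lt_one'.1.le]
    _ ≤ _ := ENNReal.tsum_comp_le_tsum_of_injective hinj _

/-! ### `Z_V(t, b') ≤ x_c + x_c^m · Z_Λ(g_R, b')` -/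

/-- `getVert` is unchanged by `transfer`. [folklore] -/
theorem getVert_transfer' {X : Type*} {G H : SimpleGraph X} {u v : X} (p : G.Walk u v)
    (hp : ∀ e ∈ p.edges, e ∈ H.edgeSet) (k : ℕ) : (p.transfer H hp).getVert k = p.getVert k := by
  induction p generalizing k with
  | nil => rfl
  | cons h p ih =>
    cases k with
    | zero => simp
    | succ k =>
      simp only [SimpleGraph.Walk.transfer, SimpleGraph.Walk.getVert_cons_succ]
      exact ih _ k

/-- Edges of a walk of `ℤ²[V]` whose vertices lie in `Λ_N` are edges of `ℤ²[Λ_N]`. [folklore] -/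
theorem edges_mem_GΛ (hN : 2 ≤ N) (hM : 2 ≤ M) {u v : Site 2}
    (p : (discreteDomainGraph (gadgetDomain N M) 1).Walk u v) (hp : ∀ w ∈ p.support, w ∈ halfBox N) :
    ∀ e ∈ p.edges, e ∈ (discreteDomainGraph (halfBoxDomain N) 1).edgeSet := by
  intro e he
  have hG := p.edges_subset_edgeSet he
  revert hG he
  refine Sym2.ind (fun x y => ?_) e
  intro he hG
  rw [SimpleGraph.mem_edgeSet] at hG ⊢
  exact (adjΛ hN).2 ⟨((adjV hN hM).1 hG).1, hp x (p.fst_mem_support_of_mem_edges he),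
    hp y (p.snd_mem_support_of_mem_edges he)⟩

/-- A SAW `t → b'` of `V` has positive length (`t ≠ b'`). [folklore] -/
theorem one_le_length_tb' (ω : DomainSAW (gadgetDomain N M) 1 ![-1, -1] ![-1, 0]) :
    1 ≤ ω.walk.length := by
  rcases Nat.eq_zero_or_pos ω.walk.length with h | h
  · exact absurd (SimpleGraph.Walk.eq_of_length_eq_zero h) (by decide)
  · exact h

/-- A SAW `t → b'` of `V` whose second vertex is `b'` is the edge `t b'` (length `1`). [folklore] -/
theorem length_eq_one_of_getVert (ω : DomainSAW (gadgetDomain N M) 1 ![-1, -1] ![-1, 0])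
    (h1 : ω.walk.getVert 1 = ![-1, 0]) : ω.walk.length = 1 := by
  have hl := one_le_length_tb' ω
  have h2 : ω.walk.getVert 1 = ω.walk.getVert ω.walk.length := by
    rw [h1, SimpleGraph.Walk.getVert_length]
  exact (ω.isPath.getVert_injOn (by simp only [mem_setOf_eq]; exact hl)
    (by simp only [mem_setOf_eq]; exact le_rfl) h2).symm

/-- **Forced traversal in the gadget**: a SAW `t → b'` of `V` whose second vertex is not `b'`
runs through the whole corridor: `getVert i = cor N M i` for `i ≤ m = 2M+N`. [folklore] -/
theorem forced_tb' (hN : 2 ≤ N) (hM : 2 ≤ M) (ω : DomainSAW (gadgetDomain N M) 1 ![-1, -1] ![-1, 0])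
    (h1 : ω.walk.getVert 1 ≠ ![-1, 0]) :
    ∀ i, i ≤ 2 * M + N → i ≤ ω.walk.length ∧ ω.walk.getVert i = cor N M i := by
  have hl := one_le_length_tb' ω
  refine getVert_eq_of_forced ω.walk ω.isPath (cor N M) (2 * M + N) (cor_zero hM) ?_ hl
    (fun i _ _ => cor_ne_b' hN i) ?_
  · -- the second vertex is a `V`-neighbour of `t` other than `b'`
    have hadj := ω.walk.adj_getVert_succ (i := 0) hl
    rw [SimpleGraph.Walk.getVert_zero, adjV hN hM] at hadj
    rcases neighbours_t hN hM hadj.2.2 hadj.1 with h | h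
    · exact absurd h h1
    · exact h
  · intro i hi1 him z hz
    rw [adjV hN hM] at hz
    exact corridor_private hN hM hi1 him hz.2.2 hz.1

/-- **Upper bound**: `Z_V(t,b') ≤ x_c + x_c^m · Z_Λ(g_R, b')`, `m = 2M + N`. [folklore] -/
theorem weight_tb'_le (hN : 2 ≤ N) (hM : 2 ≤ M) :
    SAW.weight (gadgetDomain N M) 1 ![-1, -1] ![-1, 0] univ ≤
      ENNReal.ofReal criticalFugacity +
        ENNReal.ofReal criticalFugacity ^ (2 * M + N) *
          SAW.weight (halfBoxDomain N) 1 ![-(N : ℤ), 0] ![-1, 0] univ := by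
  classical
  set m := 2 * M + N with hm
  set GV := discreteDomainGraph (gadgetDomain N M) 1 with hGV
  set GΛ := discreteDomainGraph (halfBoxDomain N) 1 with hGΛ
  -- split the SAWs `t → b'` on "second vertex = b'"
  set s : Set (DomainSAW (gadgetDomain N M) 1 ![-1, -1] ![-1, 0]) :=
    {ω | ω.walk.getVert 1 = ![-1, 0]} with hs
  rw [weight_univ]
  have key := Summable.tsum_add_tsum_compl
    (f := fun ω : DomainSAW (gadgetDomain N M) 1 ![-1, -1] ![-1, 0] =>
      ENNReal.ofReal (criticalFugacity ^ ω.length)) (s := s) ENNReal.summable ENNReal.summable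
  have h1 : ∑' ω : ↥s, ENNReal.ofReal (criticalFugacity ^ ω.1.length) ≤
      ENNReal.ofReal criticalFugacity := by
    -- (1) the edge `t b'`: at most one SAW, of weight `x_c`
    haveI : Subsingleton ↥s := ⟨fun ω₁ ω₂ => by
      have l1 := length_eq_one_of_getVert ω₁.1 ω₁.2
      have l2 := length_eq_one_of_getVert ω₂.1 ω₂.2
      rcases ω₁ with ⟨⟨p, hp⟩, hp1⟩
      rcases ω₂ with ⟨⟨q, hq⟩, hq1⟩
      simp only [hs, mem_setOf_eq] at l1 l2 hp1 hq1
      have : p = q := by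
        refine SimpleGraph.Walk.ext_getVert_le_length (l1.trans l2.symm) fun k hk => ?_
        rw [l1] at hk
        interval_cases k
        · simp
        · rw [hp1, hq1]
      subst this; rfl⟩
    rcases isEmpty_or_nonempty ↥s with hse | ⟨⟨ω₀⟩⟩
    · rw [tsum_empty]; exact bot_le
    · rw [tsum_eq_single ω₀ fun ω hω => absurd (Subsingleton.elim ω ω₀) hω]
      have := length_eq_one_of_getVert ω₀.1 ω₀.2
      rw [DomainSAW.length, this, pow_one]
  have h2 : ∑' ω : ↥sᶜ, ENNReal.ofReal (criticalFugacity ^ ω.1.length) ≤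
      ENNReal.ofReal criticalFugacity ^ m *
        SAW.weight (halfBoxDomain N) 1 ![-(N : ℤ), 0] ![-1, 0] univ := by
    -- (2) through the corridor: `ω ↦ ω.drop m`, a SAW `g_R → b'` of `Λ_N`
    rw [weight_univ]
    have hmv : ∀ ω : ↥sᶜ, ∀ i, i ≤ m → i ≤ ω.1.walk.length ∧ ω.1.walk.getVert i = cor N M i :=
      fun ω => forced_tb' hN hM ω.1 ω.2
    have hgR : ∀ ω : ↥sᶜ, ω.1.walk.getVert m = ![-(N : ℤ), 0] := fun ω => by
      rw [(hmv ω m le_rfl).2, hm, cor_m]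
    -- the remainders live in `Λ_N`
    have hsupp : ∀ ω : ↥sᶜ, ∀ w ∈ (ω.1.walk.drop m).support, w ∈ halfBox N := by
      intro ω w hw
      have havoid := drop_avoids_of_forced ω.1.walk ω.1.isPath (cor N M) m (hmv ω) w hw
      have hwV : w ∈ gadget N M := by
        have hsub : w ∈ ω.1.walk.support := by
          rw [SimpleGraph.Walk.drop_support_eq_support_drop_min] at hw
          exact List.mem_of_mem_drop hw
        exact support_subset_gadget hN hM (Or.inr (t_mem_corSet hM)) ω.1.walk w hsub
      refine mem_halfBox_of_mem_gadget hwV ?_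
      rintro ⟨i, hi, rfl⟩
      exact havoid i hi rfl
    have hedges : ∀ ω : ↥sᶜ, ∀ e ∈ ((ω.1.walk.drop m).copy (hgR ω) rfl).edges, e ∈ GΛ.edgeSet := by
      intro ω e he
      rw [SimpleGraph.Walk.edges_copy] at he
      exact edges_mem_GΛ hN hM _ (hsupp ω) e he
    set Ψ : ↥sᶜ → DomainSAW (halfBoxDomain N) 1 ![-(N : ℤ), 0] ![-1, 0] := fun ω =>
      ⟨((ω.1.walk.drop m).copy (hgR ω) rfl).transfer GΛ (hedges ω),
        (by simpa using isPath_drop ω.1.walk ω.1.isPath m : ((ω.1.walk.drop m).copy (hgR ω) rfl).IsPath).transfer _⟩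
      with hΨ
    have hΨwalk : ∀ ω : ↥sᶜ, (Ψ ω).walk =
        (((ω.1.walk.drop m).copy (hgR ω) rfl).transfer GΛ (hedges ω)) := fun ω => rfl
    have hΨlen : ∀ ω : ↥sᶜ, ω.1.length = m + (Ψ ω).length := by
      intro ω
      unfold DomainSAW.length
      rw [hΨwalk, SimpleGraph.Walk.length_transfer, SimpleGraph.Walk.length_copy,
        SimpleGraph.Walk.drop_length]
      have := (hmv ω m le_rfl).1
      omega
    have hΨget : ∀ ω : ↥sᶜ, ∀ k, (Ψ ω).walk.getVert k = ω.1.walk.getVert (m + k) := by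
      intro ω k
      rw [hΨwalk, getVert_transfer', SimpleGraph.Walk.getVert_copy, SimpleGraph.Walk.drop_getVert]
    have hinj : Function.Injective Ψ := by
      intro ω₁ ω₂ h
      have hl : (Ψ ω₁).length = (Ψ ω₂).length := by rw [h]
      have hg : ∀ k, (Ψ ω₁).walk.getVert k = (Ψ ω₂).walk.getVert k := by intro k; rw [h]
      apply Subtype.ext
      rcases ω₁ with ⟨⟨p, hp⟩, hp1⟩
      rcases ω₂ with ⟨⟨q, hq⟩, hq1⟩
      have key : p = q := by
        refine eq_of_drop_eq p q m (fun i hi => ?_) (hmv ⟨⟨p, hp⟩, hp1⟩ m le_rfl).1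
          (hmv ⟨⟨q, hq⟩, hq1⟩ m le_rfl).1 ?_ ?_
        · rw [(hmv ⟨⟨p, hp⟩, hp1⟩ i hi).2, (hmv ⟨⟨q, hq⟩, hq1⟩ i hi).2]
        · have h1 := hΨlen ⟨⟨p, hp⟩, hp1⟩
          have h2 := hΨlen ⟨⟨q, hq⟩, hq1⟩
          simp only [DomainSAW.length, SimpleGraph.Walk.drop_length] at h1 h2 hl ⊢
          omega
        · intro k
          have h1 := hΨget ⟨⟨p, hp⟩, hp1⟩ k
          have h2 := hΨget ⟨⟨q, hq⟩, hq1⟩ k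
          simp only at h1 h2
          rw [SimpleGraph.Walk.drop_getVert, SimpleGraph.Walk.drop_getVert, ← h1, ← h2, hg]
      subst key; rfl
    calc ∑' ω : ↥sᶜ, ENNReal.ofReal (criticalFugacity ^ ω.1.length)
        = ∑' ω : ↥sᶜ, ENNReal.ofReal criticalFugacity ^ m *
            (fun γ : DomainSAW (halfBoxDomain N) 1 ![-(N : ℤ), 0] ![-1, 0] =>
              ENNReal.ofReal (criticalFugacity ^ γ.length)) (Ψ ω) := by
          congr 1; funext ω
          simp only
          rw [hΨlen ω, pow_add, ENNReal.ofReal_mul (pow_nonneg criticalFugacity_pos_lt_one'.1.le _),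
            ENNReal.ofReal_pow criticalFugacity_pos_lt_one'.1.le]
      _ = ENNReal.ofReal criticalFugacity ^ m *
            ∑' ω : ↥sᶜ, (fun γ : DomainSAW (halfBoxDomain N) 1 ![-(N : ℤ), 0] ![-1, 0] =>
              ENNReal.ofReal (criticalFugacity ^ γ.length)) (Ψ ω) := ENNReal.tsum_mul_left
      _ ≤ _ := by
          gcongr
          exact ENNReal.tsum_comp_le_tsum_of_injective hinj _
  calc ∑' ω : DomainSAW (gadgetDomain N M) 1 ![-1, -1] ![-1, 0],
        ENNReal.ofReal (criticalFugacity ^ ω.length)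
      = (∑' ω : ↥s, ENNReal.ofReal (criticalFugacity ^ ω.1.length)) +
          ∑' ω : ↥sᶜ, ENNReal.ofReal (criticalFugacity ^ ω.1.length) :=
        key.symm
    _ ≤ _ := add_le_add h1 h2

end Summit.CriticalPhenomena.SAWScalingLimit.Theorems.BoundaryHarnack.Negative
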